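import Summits.CriticalPhenomena.SAWScalingLimit.Theses.SAWTrackTransport
import Literature.Probability.RandomPlanarGeometry.YangBaxterSAWComplex
import Literature.Probability.RandomPlanarGeometry.LatticeSimilarityCovariance
import Literature.Probability.RandomPlanarGeometry.ConformalRestrictionProofs
import Summits.CriticalPhenomena.SAWScalingLimit.Theorems.SAWDevelopingMapHexTransferThirdBdryEndpointsGeometry
import Summits.CriticalPhenomena.SAWScalingLimit.Theorems.SAWDevelopingMapHexTransferPortTransferWeakLimit
import HarnessLib

/-!
# Crux `MirrorRotation` (stmt-CriticalPhenomena-16997) of route `SAWTrackTransport` — PROVED (line `grid_transpose`)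

Landing target (prover): `Summits/CriticalPhenomena/SAWScalingLimit/Theorems/SAWTrackTransportMirrorRotation.lean`
with `--workitem stmt-CriticalPhenomena-16997`; the last theorem `mirrorRotation` has type
`Summit.CriticalPhenomena.SAWScalingLimit.Theses.SAWTrackTransport.MirrorRotation` (the route decl, BY NAME) and the
whole file is sorry-free (axioms propext / Classical.choice / Quot.sound).  Assembled by the crux strategist
planner-cstrat-stmt-CriticalPhenomena-16997-b1-0 (2026-08-17) from the registered skeleton
`Cruxes/MirrorRotation/Lines/grid_transpose.lean` and the five stub proofs, each also attached separately as a
ready-to-land `Theorems/SAWTrackTransportMirrorRotation<Stub>.lean`.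

**The reflection trick** (H. Duminil-Copin, K. K. Kozlowski, D. Krachun, I. Manolescu, M. Oulamara, *Rotational
invariance in critical planar lattice models*, arXiv:2012.11672, §7.1, case `Ω = ℝ²`, transposed to chordal curve
families): angle universality `AU` of the robust full limit `P` of the critical Glazman–Manolescu Yang–Baxter walk,
endpoint approximations at every angle `α ∈ [π/3, 2π/3]` and `RL(π/2) P` give covariance of `P` under every rotation
about the origin.  Five steps: (S1) the mirror of the constant-angle-`α` tiling is the face transposition, a
weight-preserving equivalence of walk types (via the transposed grid complex and `Cx.Emb`,
`YangBaxterSAWComplex.lean`); (S2) the lattice mirror `m_{α,δ} : z ↦ e^{iα} z̄ − (iδ/2)(1 + e^{iα})` intertwines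
the mid-edge embedding, transposes the discretisation, is `|δ|`-close to `m_α` and affine on segments; (S3) a
weight-preserving intertwined equivalence transports the critical finite-volume curve law; (S4) exact finite-volume
symmetries `T_δ → S` pass to robust limits, `P (S D) = S_* (P D)` (here `S = m_α`, `T_δ = m_{α,δ}`,
`u_δ = δ c_α`); (S5) mirrors at all angles of `[π/3, 2π/3]` generate all rotations.

References: DKKMO arXiv:2012.11672 §7.1; A. Glazman, I. Manolescu, arXiv:1708.00395, §§1, 3; P. Billingsley,
*Convergence of probability measures* (1999), Thms 1.2, 2.7, 3.1.  Bookkeeping lemmas tagged [folklore].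
-/

noncomputable section

open MeasureTheory Filter Topology
open scoped ComplexConjugate BoundedContinuousFunction
open Complex (I)
open Literature.Probability.LatticeModels (polyline polylineFrom)
open Literature.Probability.RandomPlanarGeometry
open Literature.Probability.RandomPlanarGeometry.SAW.YangBaxter
open Summit.CriticalPhenomena.SAWScalingLimit.Cruxes.HexTransfer.YbRelay.ThirdEndpoints (colOffset_const planeCorner_const)
open Summit.CriticalPhenomena.SAWScalingLimit.Cruxes.HexTransfer.Sketch.PortTransfer (tendstoLaw_of_dist_le)

namespace Summit.CriticalPhenomena.SAWScalingLimit.Cruxes.MirrorRotation.GridTranspose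

/-! ## TransposeWalks -/


namespace TransposeWalksProof
/-! ### The side permutation and the edge transposition -/

/-- The side permutation of the mirror: `W ↔ S`, `E ↔ N`. [folklore] -/
def tSide : Side → Side
  | .W => .S
  | .S => .W
  | .E => .N
  | .N => .E

/-- Bookkeeping. [folklore] -/
@[simp] theorem tSide_tSide (s : Side) : tSide (tSide s) = s := by cases s <;> rfl

/-- Arc kinds are invariant under the side permutation (corner ↔ corner, coCorner ↔ coCorner,
straight ↔ straight). [folklore] -/
theorem arcKind_tSide (s t : Side) : arcKind (tSide s) (tSide t) = arcKind s t := by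
  cases s <;> cases t <;> rfl

/-- The mid-edge transposition. [folklore] -/
def tEdge : MidEdge → MidEdge
  | .vert k j => .slant j k
  | .slant k j => .vert j k

/-- Bookkeeping. [folklore] -/
@[simp] theorem tEdge_vert (k j : ℤ) : tEdge (.vert k j) = .slant j k := rfl
/-- Bookkeeping. [folklore] -/
@[simp] theorem tEdge_slant (k j : ℤ) : tEdge (.slant k j) = .vert j k := rfl
/-- Bookkeeping. [folklore] -/
@[simp] theorem tEdge_tEdge (e : MidEdge) : tEdge (tEdge e) = e := by cases e <;> rfl

/-- Bookkeeping. [folklore] -/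
theorem tEdge_injective : Function.Injective tEdge :=
  Function.LeftInverse.injective tEdge_tEdge

/-! ### The transposed grid complex -/

/-- The grid with its side labels permuted by `tSide` (same faces, edges, `commonFace`, angles). [folklore] -/
def gridCxT (Θ : ℤ → ℝ) : Cx Face MidEdge where
  side f s := Face.side f (tSide s)
  sideOf f e := (Face.sideOf f e).map tSide
  commonFace := MidEdge.commonFace
  angle f := Θ f.1

/-- Bookkeeping. [folklore] -/
theorem gridCxT_lawful (Θ : ℤ → ℝ) : (gridCxT Θ).Lawful where
  sideOf_eq_some_iff f e s := by
    change (Face.sideOf f e).map tSide = some s ↔ Face.side f (tSide s) = e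
    rw [Option.map_eq_some_iff]
    constructor
    · rintro ⟨t, ht, rfl⟩
      rw [tSide_tSide]
      exact (Face.sideOf_eq_some_iff f e t).1 ht
    · intro h
      exact ⟨tSide s, (Face.sideOf_eq_some_iff f e _).2 h, tSide_tSide s⟩
  commonFace_eq_some_iff e e' f := by
    change MidEdge.commonFace e e' = some f ↔
      e ≠ e' ∧ (∃ s, Face.side f (tSide s) = e) ∧ ∃ t, Face.side f (tSide t) = e'
    rw [MidEdge.commonFace_eq_some_iff]
    have key : ∀ x : MidEdge, (∃ s, Face.side f s = x) ↔ ∃ s, Face.side f (tSide s) = x := fun x =>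
      ⟨fun ⟨s, hs⟩ => ⟨tSide s, by rw [tSide_tSide]; exact hs⟩, fun ⟨s, hs⟩ => ⟨tSide s, hs⟩⟩
    rw [key e, key e']

/-- The transposed grid has the same walks as the grid (only `noncross` mentions `side`, and it is
symmetric in the two straights). [folklore] -/
theorem isWalk_gridCxT_iff (Θ : ℤ → ℝ) {D : Set Face} {a z : MidEdge} {m : List MidEdge} :
    (gridCxT Θ).IsWalk D a z m ↔ (gridCx Θ).IsWalk D a z m := by
  constructor
  · intro h
    exact ⟨h.head_eq, h.getLast_eq, h.nodup, h.arc_mem, h.isChain, fun f hWE hSN => h.noncross f hSN hWE⟩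
  · intro h
    exact ⟨h.head_eq, h.getLast_eq, h.nodup, h.arc_mem, h.isChain, fun f hWE hSN => h.noncross f hSN hWE⟩

/-- The transposed grid reads the same arc kinds. [folklore] -/
theorem arcKindOf_gridCxT (Θ : ℤ → ℝ) (p : MidEdge × MidEdge) :
    (gridCxT Θ).arcKindOf p = (gridCx Θ).arcKindOf p := by
  change ((MidEdge.commonFace p.1 p.2).bind fun f =>
      match (Face.sideOf f p.1).map tSide, (Face.sideOf f p.2).map tSide with
      | some s, some t => some (arcKind s t)
      | _, _ => none) =
    ((MidEdge.commonFace p.1 p.2).bind fun f =>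
      match Face.sideOf f p.1, Face.sideOf f p.2 with
      | some s, some t => some (arcKind s t)
      | _, _ => none)
  cases MidEdge.commonFace p.1 p.2 with
  | none => rfl
  | some f =>
    simp only [Option.bind_some]
    cases Face.sideOf f p.1 <;> cases Face.sideOf f p.2 <;> simp [arcKind_tSide]

/-- … hence the same kinds inside every face … [folklore] -/
theorem kindsIn_gridCxT (Θ : ℤ → ℝ) (m : List MidEdge) (f : Face) :
    (gridCxT Θ).kindsIn m f = (gridCx Θ).kindsIn m f := by
  unfold Cx.kindsIn
  congr 1
  funext p
  rw [arcKindOf_gridCxT]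
  rfl

/-- … and the same weights. [folklore] -/
theorem weight_gridCxT (Θ : ℤ → ℝ) (m : List MidEdge) : (gridCxT Θ).weight m = (gridCx Θ).weight m := by
  unfold Cx.weight
  refine Finset.prod_congr rfl fun f _ => ?_
  rw [kindsIn_gridCxT]
  rfl

/-! ### The mirror as an embedding `gridCx α ↪ gridCxT α` -/

/-- `(Prod.swap, tEdge)` embeds the constant-angle grid into the transposed grid (on any face set). [folklore] -/
def embT (α : ℝ) (D : Set Face) : Cx.Emb (gridCx (fun (_ : ℤ) => α)) (gridCxT (fun (_ : ℤ) => α)) D where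
  φF := Prod.swap
  φE := tEdge
  injE := tEdge_injective
  injF := Prod.swap_injective.injOn
  side_eq f _ s := by
    obtain ⟨k, j⟩ := f
    cases s <;> rfl
  angle_eq _ _ := rfl

/-- Transport of a grid walk along the transposition. [folklore] -/
theorem isWalk_transpose (α : ℝ) {D : Set Face} {a z : MidEdge} {m : List MidEdge}
    (hm : (gridCx (fun (_ : ℤ) => α)).IsWalk D a z m) :
    (gridCx (fun (_ : ℤ) => α)).IsWalk (Prod.swap '' D) (tEdge a) (tEdge z) (m.map tEdge) :=
  (isWalk_gridCxT_iff _).1 ((embT α D).isWalk_map (gridCx_lawful _) (gridCxT_lawful _) hm)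

/-- … and of its weight. [folklore] -/
theorem weight_transpose (α : ℝ) {D : Set Face} {a z : MidEdge} {m : List MidEdge}
    (hm : (gridCx (fun (_ : ℤ) => α)).IsWalk D a z m) :
    (gridCx (fun (_ : ℤ) => α)).weight (m.map tEdge) = (gridCx (fun (_ : ℤ) => α)).weight m := by
  rw [← weight_gridCxT]
  exact (embT α D).weight_map (gridCx_lawful _) (gridCxT_lawful _) hm

/-- Bookkeeping. [folklore] -/
theorem swap_image_swap_image (D : Set Face) : Prod.swap '' (Prod.swap '' D) = D := by
  rw [Set.image_image]
  simp

/-! ### S1 -/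

/-- The transposition of `YBWalk`s (forward map). [folklore] -/
def transposeWalk (α : ℝ) {D : Set Face} {a z : MidEdge} (γ : YBWalk D a z) :
    YBWalk (Prod.swap '' D) (tEdge a) (tEdge z) :=
  YBWalk.ofIsWalk (isWalk_transpose α (γ.isWalk_mids (fun (_ : ℤ) => α)))

/-- Bookkeeping. [folklore] -/
@[simp] theorem mids_transposeWalk (α : ℝ) {D : Set Face} {a z : MidEdge} (γ : YBWalk D a z) :
    (transposeWalk α γ).mids = γ.mids.map tEdge := rfl

/-- The transposition of `YBWalk`s (backward map, types fixed up along `swap ∘ swap = id`,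
`tEdge ∘ tEdge = id`). [folklore] -/
def untransposeWalk (α : ℝ) {D : Set Face} {a z : MidEdge} (γ : YBWalk (Prod.swap '' D) (tEdge a) (tEdge z)) :
    YBWalk D a z :=
  YBWalk.ofIsWalk (Θ := fun (_ : ℤ) => α) (by
    simpa only [swap_image_swap_image, tEdge_tEdge] using
      isWalk_transpose α (γ.isWalk_mids (fun (_ : ℤ) => α)))

/-- Bookkeeping. [folklore] -/
@[simp] theorem mids_untransposeWalk (α : ℝ) {D : Set Face} {a z : MidEdge}
    (γ : YBWalk (Prod.swap '' D) (tEdge a) (tEdge z)) : (untransposeWalk α γ).mids = γ.mids.map tEdge := rfl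

/-- **S1 with `E := tEdge`.** [folklore] -/
def transposeEquiv (α : ℝ) (D : Set Face) (a z : MidEdge) :
    YBWalk D a z ≃ YBWalk (Prod.swap '' D) (tEdge a) (tEdge z) where
  toFun := transposeWalk α
  invFun := untransposeWalk α
  left_inv γ := YBWalk.ext (by simp [List.map_map, Function.comp_def])
  right_inv γ := YBWalk.ext (by simp [List.map_map, Function.comp_def])

/-- Bookkeeping. [folklore] -/
theorem transposeWalks (α : ℝ) (D : Set Face) (a z : MidEdge) :
    ∃ e : YBWalk D a z ≃ YBWalk (Prod.swap '' D) (tEdge a) (tEdge z),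
      ∀ γ : YBWalk D a z, (e γ).mids = γ.mids.map tEdge ∧
        (e γ).weight (fun (_ : ℤ) => α) = γ.weight (fun (_ : ℤ) => α) :=
  ⟨transposeEquiv α D a z, fun γ => ⟨rfl, by
    rw [← YBWalk.weight_gridCx, ← YBWalk.weight_gridCx]
    exact weight_transpose α (γ.isWalk_mids _)⟩⟩

/-- The registered form, inside the proof namespace. [folklore] -/
theorem stub_transposeWalks_holds :
    ∀ (E : MidEdge → MidEdge), (∀ k j : ℤ, E (MidEdge.vert k j) = MidEdge.slant j k) →
      (∀ k j : ℤ, E (MidEdge.slant k j) = MidEdge.vert j k) →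
      ∀ (α : ℝ) (D : Set Face) (a z : MidEdge),
        ∃ e : YBWalk D a z ≃ YBWalk (Prod.swap '' D) (E a) (E z),
          ∀ γ : YBWalk D a z, (e γ).mids = γ.mids.map E ∧
            (e γ).weight (fun (_ : ℤ) => α) = γ.weight (fun (_ : ℤ) => α) := by
  intro E hv hs
  obtain rfl : E = tEdge := funext fun e => by cases e <;> simp [hv, hs]
  exact transposeWalks


end TransposeWalksProof

/-- **Stub `stub_transposeWalks` of line `grid_transpose` (crux `MirrorRotation`, stmt-CriticalPhenomena-16997),
VERBATIM.**  For every mid-edge map `E` with `E (vert k j) = slant j k`, `E (slant k j) = vert j k`, every constant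
angle `α`, every face set `D` and mid-edges `a, z`: a weight-preserving equivalence
`YBWalk D a z ≃ YBWalk (swap '' D) (E a) (E z)` acting on edge lists by `E` (the transposition of
Glazman–Manolescu's face walk, through the transposed grid complex). [folklore] -/
theorem stub_transposeWalks :
    ∀ (E : MidEdge → MidEdge), (∀ k j : ℤ, E (MidEdge.vert k j) = MidEdge.slant j k) →
      (∀ k j : ℤ, E (MidEdge.slant k j) = MidEdge.vert j k) →
      ∀ (α : ℝ) (D : Set Face) (a z : MidEdge),
        ∃ e : YBWalk D a z ≃ YBWalk (Prod.swap '' D) (E a) (E z),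
          ∀ γ : YBWalk D a z, (e γ).mids = γ.mids.map E ∧
            (e γ).weight (fun (_ : ℤ) => α) = γ.weight (fun (_ : ℤ) => α) :=
  TransposeWalksProof.stub_transposeWalks_holds



/-! ## LatticeMirrorGeometry -/


namespace LatticeMirrorGeometryProof

/-! ### The mid-edge transposition -/

def tEdge : MidEdge → MidEdge
  | .vert k j => .slant j k
  | .slant k j => .vert j k

/-- Bookkeeping. [folklore] -/
@[simp] theorem tEdge_vert (k j : ℤ) : tEdge (.vert k j) = .slant j k := rfl
/-- Bookkeeping. [folklore] -/
@[simp] theorem tEdge_slant (k j : ℤ) : tEdge (.slant k j) = .vert j k := rfl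

/-! ### The unit vectors `u = e^{iα}`, `w = sin α − i cos α` and the mirror -/

/-- `u = e^{iα}`. [folklore] -/
abbrev u (α : ℝ) : ℂ := Complex.exp ((α : ℂ) * I)

/-- `w = sin α − i cos α` (the column side vector `colShift`). [folklore] -/
abbrev w (α : ℝ) : ℂ := (Real.sin α : ℂ) - (Real.cos α : ℂ) * I

/-- Bookkeeping. [folklore] -/
theorem u_eq (α : ℝ) : u α = (Real.cos α : ℂ) + (Real.sin α : ℂ) * I := by
  rw [u, Complex.exp_mul_I, ← Complex.ofReal_cos, ← Complex.ofReal_sin]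

/-- Bookkeeping. [folklore] -/
theorem colShift_const (α : ℝ) (k : ℤ) : colShift (fun (_ : ℤ) => α) k = w α := rfl

/-- `sin² + cos² = 1` in `ℂ`. [folklore] -/
theorem sin_sq_add_cos_sq_C (α : ℝ) : (Real.sin α : ℂ) ^ 2 + (Real.cos α : ℂ) ^ 2 = 1 := by
  exact_mod_cast Real.sin_sq_add_cos_sq α

/-- (A1) `u · conj i = w`. [folklore] -/
theorem u_mul_conj_I (α : ℝ) : u α * conj I = w α := by
  rw [u_eq, Complex.conj_I]
  ring_nf
  rw [Complex.I_sq]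
  ring

/-- (A2) `u · conj w = i`. [folklore] -/
theorem u_mul_conj_w (α : ℝ) : u α * conj (w α) = I := by
  rw [u_eq, w, map_sub, map_mul, Complex.conj_ofReal, Complex.conj_ofReal, Complex.conj_I]
  have h := sin_sq_add_cos_sq_C α
  ring_nf
  rw [Complex.I_sq]
  linear_combination I * h

/-- (A3) `u · conj u = 1`. [folklore] -/
theorem u_mul_conj_u (α : ℝ) : u α * conj (u α) = 1 := by
  rw [u_eq, map_add, map_mul, Complex.conj_ofReal, Complex.conj_ofReal, Complex.conj_I]
  have h := sin_sq_add_cos_sq_C α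
  ring_nf
  rw [Complex.I_sq]
  linear_combination h

/-- The lattice mirror `M α δ : z ↦ u z̄ − (iδ/2)(1 + u)` (spelled exactly as in the stub). [folklore] -/
abbrev M (α δ : ℝ) : ℂ ≃ₜ ℂ :=
  Complex.conjLIE.toHomeomorph.trans
    (similarity (Complex.exp ((α : ℂ) * Complex.I)) (Complex.exp_ne_zero _)
      (-((δ : ℂ) * Complex.I * (1 + Complex.exp ((α : ℂ) * Complex.I)) / 2)))

/-- Bookkeeping. [folklore] -/
theorem M_apply (α δ : ℝ) (z : ℂ) : M α δ z = u α * conj z + -((δ : ℂ) * I * (1 + u α) / 2) :=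
  conjLIE_toHomeomorph_trans_similarity_apply _ _ _ z

/-- `M α δ` is an involution. [folklore] -/
theorem M_M (α δ : ℝ) (z : ℂ) : M α δ (M α δ z) = z := by
  rw [M_apply, M_apply, map_add, map_mul, map_neg, map_div₀, map_mul, map_mul, map_add, map_one,
    Complex.conj_ofReal, Complex.conj_I, Complex.conj_conj, map_ofNat]
  have h3 := u_mul_conj_u α
  linear_combination (z + (δ : ℂ) * I / 2) * h3

/-- Mesh scaling: `M α δ (δ z) = δ · M α 1 z`. [folklore] -/
theorem M_smul (α δ : ℝ) (z : ℂ) : M α δ ((δ : ℂ) * z) = (δ : ℂ) * M α 1 z := by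
  rw [M_apply, M_apply, map_mul, Complex.conj_ofReal]
  push_cast
  ring

/-! ### (G1) the mid-edge embedding is intertwined -/

theorem planeMidpoint_vert (α : ℝ) (k j : ℤ) :
    planeMidpoint (fun (_ : ℤ) => α) (.vert k j) = (k : ℂ) * w α + (j : ℂ) * I := by
  rw [planeMidpoint, planeCorner_const]
  ring

/-- Bookkeeping. [folklore] -/
theorem planeMidpoint_slant (α : ℝ) (k j : ℤ) :
    planeMidpoint (fun (_ : ℤ) => α) (.slant k j) = (k : ℂ) * w α + ((j : ℂ) - 1 / 2) * I + w α / 2 := by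
  rw [planeMidpoint, planeCorner_const, colShift_const]

/-- (A1') `u · i = −w`. [folklore] -/
theorem u_mul_I (α : ℝ) : u α * I = -w α := by
  have h := u_mul_conj_I α
  rw [Complex.conj_I, mul_neg] at h
  linear_combination -h

/-- (A2') `u · (sin α + i cos α) = i` (`conj w` in normal form). [folklore] -/
theorem u_mul_conj_w' (α : ℝ) : u α * ((Real.sin α : ℂ) + (Real.cos α : ℂ) * I) = I := by
  have h := u_mul_conj_w α
  rw [w, map_sub, map_mul, Complex.conj_ofReal, Complex.conj_ofReal, Complex.conj_I, mul_neg,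
    sub_neg_eq_add] at h
  exact h

/-- Bookkeeping. [folklore] -/
theorem planeMidpoint_tEdge_one (α : ℝ) (x : MidEdge) :
    planeMidpoint (fun (_ : ℤ) => α) (tEdge x) = M α 1 (planeMidpoint (fun (_ : ℤ) => α) x) := by
  have h1 := u_mul_I α
  have h2 := u_mul_conj_w' α
  cases x with
  | vert k j =>
    rw [tEdge_vert, planeMidpoint_slant, M_apply, planeMidpoint_vert]
    simp only [map_add, map_sub, map_mul, map_intCast, Complex.conj_ofReal, Complex.conj_I]
    simp only [Complex.ofReal_one, one_mul]
    linear_combination (-(k : ℂ)) * h2 + ((j : ℂ) + 1 / 2) * h1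
  | slant k j =>
    rw [tEdge_slant, planeMidpoint_vert, M_apply, planeMidpoint_slant]
    simp only [map_add, map_sub, map_mul, map_div₀, map_intCast, map_one, map_ofNat, Complex.conj_ofReal,
      Complex.conj_I]
    simp only [Complex.ofReal_one, one_mul]
    linear_combination (-(k : ℂ) - 1 / 2) * h2 + (j : ℂ) * h1

/-- Bookkeeping. [folklore] -/
theorem G1 (α δ : ℝ) (x : MidEdge) :
    (δ : ℂ) * planeMidpoint (fun (_ : ℤ) => α) (tEdge x) = M α δ ((δ : ℂ) * planeMidpoint (fun (_ : ℤ) => α) x) := by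
  rw [M_smul, planeMidpoint_tEdge_one]

/-! ### (G2) the discretisation is transposed -/

/-- `M α 1` as a real-affine self-map of `ℂ`. [folklore] -/
def Maff (α : ℝ) : ℂ →ᵃ[ℝ] ℂ :=
  ((LinearMap.mulLeft ℝ (u α)).comp Complex.conjAe.toLinearMap).toAffineMap +
    AffineMap.const ℝ ℂ (-((1 : ℝ) * I * (1 + u α) / 2) : ℂ)

/-- Bookkeeping. [folklore] -/
theorem Maff_apply (α : ℝ) (z : ℂ) : Maff α z = M α 1 z := by
  rw [M_apply]
  simp [Maff]

/-- Bookkeeping. [folklore] -/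
theorem coe_Maff (α : ℝ) : ⇑(Maff α) = M α 1 := funext (Maff_apply α)

/-- Bookkeeping. [folklore] -/
theorem M_one_planeCorner (α : ℝ) (k j : ℤ) :
    M α 1 (planeCorner (fun (_ : ℤ) => α) (k, j)) = planeCorner (fun (_ : ℤ) => α) (j, k) := by
  have h1 := u_mul_I α
  have h2 := u_mul_conj_w' α
  rw [M_apply, planeCorner_const, planeCorner_const]
  simp only [map_add, map_sub, map_mul, map_div₀, map_intCast, map_one, map_ofNat, Complex.conj_ofReal,
    Complex.conj_I]
  simp only [Complex.ofReal_one, one_mul]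
  linear_combination (k : ℂ) * h2 - (j : ℂ) * h1

/-- Bookkeeping. [folklore] -/
theorem M_one_add (α : ℝ) (z v : ℂ) : M α 1 (z + v) = M α 1 z + u α * conj v := by
  rw [M_apply, M_apply, map_add]
  ring

/-- Bookkeeping. [folklore] -/
theorem image_cornerSet (α : ℝ) (k j : ℤ) :
    M α 1 '' cornerSet (fun (_ : ℤ) => α) (k, j) = cornerSet (fun (_ : ℤ) => α) (j, k) := by
  have h1 := u_mul_conj_I α
  have h2 := u_mul_conj_w α
  simp only [cornerSet, Set.image_insert_eq, Set.image_singleton, colShift_const]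
  rw [show planeCorner (fun (_ : ℤ) => α) (k, j) + I + w α = (planeCorner (fun (_ : ℤ) => α) (k, j) + I) + w α
      from rfl, M_one_add, M_one_add, M_one_add, M_one_add, M_one_planeCorner, h1, h2]
  rw [Set.insert_comm (planeCorner (fun (_ : ℤ) => α) (j, k) + w α)]
  congr 3
  rw [add_right_comm]

/-- Bookkeeping. [folklore] -/
theorem image_rhombus (α : ℝ) (f : Face) :
    M α 1 '' rhombus (fun (_ : ℤ) => α) f = rhombus (fun (_ : ℤ) => α) f.swap := by
  obtain ⟨k, j⟩ := f
  rw [rhombus, rhombus, ← coe_Maff, AffineMap.image_convexHull, coe_Maff, image_cornerSet]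
  rfl

/-- Bookkeeping. [folklore] -/
theorem mem_image_M_iff (α δ : ℝ) (Ω : Set ℂ) (y : ℂ) : y ∈ M α δ '' Ω ↔ M α δ y ∈ Ω := by
  constructor
  · rintro ⟨x, hx, rfl⟩
    rwa [M_M]
  · intro h
    exact ⟨M α δ y, h, M_M α δ y⟩

/-- Bookkeeping. [folklore] -/
theorem G2 (α δ : ℝ) (Ω : Set ℂ) :
    meshFaces (fun (_ : ℤ) => α) (M α δ '' Ω) δ = Prod.swap '' meshFaces (fun (_ : ℤ) => α) Ω δ := by
  rw [Set.image_swap_eq_preimage_swap]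
  ext f
  rw [Set.mem_preimage, mem_meshFaces_iff, mem_meshFaces_iff, ← image_rhombus, Set.forall_mem_image]
  refine forall₂_congr fun z _ => ?_
  rw [mem_image_M_iff, M_smul]

/-! ### (G3) `|δ|`-closeness to the mirror through the origin, (G4) affinity on segments -/

theorem G3 (α δ : ℝ) (z : ℂ) :
    dist (M α δ z) ((Complex.conjLIE.toHomeomorph.trans
      (similarity (Complex.exp ((α : ℂ) * Complex.I)) (Complex.exp_ne_zero _) 0)) z) ≤ |δ| := by
  rw [M_apply, conjLIE_toHomeomorph_trans_similarity_apply, dist_eq_norm]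
  have h1 : ‖u α‖ = 1 := Complex.norm_exp_ofReal_mul_I α
  have h2 : ‖(1 : ℂ) + u α‖ ≤ 2 := by
    calc ‖(1 : ℂ) + u α‖ ≤ ‖(1 : ℂ)‖ + ‖u α‖ := norm_add_le _ _
      _ = 2 := by rw [h1, norm_one]; norm_num
  have : u α * conj z + -((δ : ℂ) * I * (1 + u α) / 2) - (u α * conj z + 0) = -((δ : ℂ) * I * (1 + u α) / 2) := by
    ring
  rw [this, norm_neg, norm_div, norm_mul, norm_mul, Complex.norm_real, Complex.norm_I, mul_one,
    Complex.norm_ofNat, Real.norm_eq_abs]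
  calc |δ| * ‖1 + u α‖ / 2 ≤ |δ| * 2 / 2 := by gcongr
    _ = |δ| := by ring

/-- Bookkeeping. [folklore] -/
theorem G4 (α δ : ℝ) (x y : ℂ) (t : ℝ) :
    M α δ (AffineMap.lineMap x y t) = AffineMap.lineMap (M α δ x) (M α δ y) t := by
  rw [AffineMap.lineMap_apply_module, AffineMap.lineMap_apply_module, M_apply, M_apply, M_apply]
  simp only [Complex.real_smul, map_add, map_mul, Complex.conj_ofReal]
  push_cast
  ring


end LatticeMirrorGeometryProof

open LatticeMirrorGeometryProof in
/-- **Stub `stub_latticeMirrorGeometry` of line `grid_transpose` (crux `MirrorRotation`,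
stmt-CriticalPhenomena-16997), VERBATIM**: (G1) midpoint intertwining, (G2) mesh transposition, (G3) `|δ|`-closeness
to the mirror through the origin, (G4) affinity on segments, for the lattice mirror
`z ↦ e^{iα} z̄ − (iδ/2)(1 + e^{iα})` and all real `α, δ`. [folklore] -/
theorem stub_latticeMirrorGeometry :
    ∀ (E : MidEdge → MidEdge), (∀ k j : ℤ, E (MidEdge.vert k j) = MidEdge.slant j k) →
      (∀ k j : ℤ, E (MidEdge.slant k j) = MidEdge.vert j k) →
      ∀ (α δ : ℝ),
        (∀ x : MidEdge, (δ : ℂ) * planeMidpoint (fun (_ : ℤ) => α) (E x) =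
          (Complex.conjLIE.toHomeomorph.trans
            (similarity (Complex.exp ((α : ℂ) * Complex.I)) (Complex.exp_ne_zero _)
              (-((δ : ℂ) * Complex.I * (1 + Complex.exp ((α : ℂ) * Complex.I)) / 2))))
            ((δ : ℂ) * planeMidpoint (fun (_ : ℤ) => α) x)) ∧
        (∀ Ω : Set ℂ, meshFaces (fun (_ : ℤ) => α)
            ((Complex.conjLIE.toHomeomorph.trans
              (similarity (Complex.exp ((α : ℂ) * Complex.I)) (Complex.exp_ne_zero _)
                (-((δ : ℂ) * Complex.I * (1 + Complex.exp ((α : ℂ) * Complex.I)) / 2)))) '' Ω) δ =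
          Prod.swap '' meshFaces (fun (_ : ℤ) => α) Ω δ) ∧
        (∀ z : ℂ, dist
            ((Complex.conjLIE.toHomeomorph.trans
              (similarity (Complex.exp ((α : ℂ) * Complex.I)) (Complex.exp_ne_zero _)
                (-((δ : ℂ) * Complex.I * (1 + Complex.exp ((α : ℂ) * Complex.I)) / 2)))) z)
            ((Complex.conjLIE.toHomeomorph.trans
              (similarity (Complex.exp ((α : ℂ) * Complex.I)) (Complex.exp_ne_zero _) 0)) z) ≤ |δ|) ∧
        (∀ (x y : ℂ) (t : ℝ),
          (Complex.conjLIE.toHomeomorph.trans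
            (similarity (Complex.exp ((α : ℂ) * Complex.I)) (Complex.exp_ne_zero _)
              (-((δ : ℂ) * Complex.I * (1 + Complex.exp ((α : ℂ) * Complex.I)) / 2))))
            (AffineMap.lineMap x y t) =
          AffineMap.lineMap
            ((Complex.conjLIE.toHomeomorph.trans
              (similarity (Complex.exp ((α : ℂ) * Complex.I)) (Complex.exp_ne_zero _)
                (-((δ : ℂ) * Complex.I * (1 + Complex.exp ((α : ℂ) * Complex.I)) / 2)))) x)
            ((Complex.conjLIE.toHomeomorph.trans
              (similarity (Complex.exp ((α : ℂ) * Complex.I)) (Complex.exp_ne_zero _)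
                (-((δ : ℂ) * Complex.I * (1 + Complex.exp ((α : ℂ) * Complex.I)) / 2)))) y) t) := by
  intro E hv hs α δ
  obtain rfl : E = tEdge := funext fun e => by cases e <;> simp [hv, hs]
  exact ⟨G1 α δ, G2 α δ, G3 α δ, G4 α δ⟩



/-! ## LawTransport -/


namespace LawTransportProof

/-- A map affine on segments commutes with `polylineFrom`, pointwise in time (both sides carry the same dyadic
`Path.trans` parametrisation); copy of `PinTheShear.apply_polylineFrom_of_lineMap`. [folklore] -/
theorem apply_polylineFrom_of_lineMap (f : ℂ → ℂ)
    (hf : ∀ (x y : ℂ) (c : ℝ), f (AffineMap.lineMap x y c) = AffineMap.lineMap (f x) (f y) c)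
    (x : ℂ) (l : List ℂ) (t : unitInterval) :
    f ((polylineFrom x l).2 t) = (polylineFrom (f x) (l.map f)).2 t := by
  induction l generalizing x t with
  | nil => rfl
  | cons y l ih =>
    change f (((Path.segment x y).trans (polylineFrom y l).2) t) =
      ((Path.segment (f x) (f y)).trans (polylineFrom (f y) (l.map f)).2) t
    rw [Path.trans_apply, Path.trans_apply]
    split_ifs with h
    · simp [Path.segment_apply, hf]
    · exact ih y _

/-- A polyline through a nonempty list of `F`-images is `F ∘` the polyline, pointwise in time. [folklore] -/
theorem polyline_map_cons (f : ℂ → ℂ)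
    (hf : ∀ (x y : ℂ) (c : ℝ), f (AffineMap.lineMap x y c) = AffineMap.lineMap (f x) (f y) c)
    (x : ℂ) (l : List ℂ) (t : unitInterval) :
    polyline ((x :: l).map f) t = f (polyline (x :: l) t) := by
  rw [List.map_cons]
  exact (apply_polylineFrom_of_lineMap f hf x l t).symm

variable {Θ : ℤ → ℝ} {δ : ℝ} {Ω Ω' : Set ℂ} {a b a' b' : MidEdge} {E : MidEdge → MidEdge} {F : ℂ ≃ₜ ℂ}
  (e : YangBaxterSAW Θ Ω δ a b ≃ YangBaxterSAW Θ Ω' δ a' b')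
  (hF : ∀ (x y : ℂ) (t : ℝ), F (AffineMap.lineMap x y t) = AffineMap.lineMap (F x) (F y) t)
  (hpt : ∀ x : MidEdge, (δ : ℂ) * planeMidpoint Θ (E x) = F ((δ : ℂ) * planeMidpoint Θ x))
  (hmids : ∀ γ : YangBaxterSAW Θ Ω δ a b, (e γ).mids = γ.mids.map E)
  (hwt : ∀ γ : YangBaxterSAW Θ Ω δ a b, (e γ).weight Θ = γ.weight Θ)

include hpt hmids in
/-- The rescaled points of the image walk are the `F`-images of the points. [folklore] -/
theorem points_equiv (γ : YangBaxterSAW Θ Ω δ a b) : (e γ).points Θ δ = (γ.points Θ δ).map F := by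
  rw [YBWalk.points, YBWalk.points, hmids, List.map_map, List.map_map]
  refine List.map_congr_left fun x _ => ?_
  simp only [Function.comp_apply, hpt]

include hF hpt hmids in
/-- **The curve of the image walk is the image curve.** [folklore] -/
theorem curve_equiv (γ : YangBaxterSAW Θ Ω δ a b) :
    (e γ).curve Θ δ = CurveClass.map (F : C(ℂ, ℂ)) (γ.curve Θ δ) := by
  rw [YBWalk.curve, YBWalk.curve, CurveClass.map_mk]
  congr 1
  ext t
  change (e γ).path Θ δ t = F (γ.path Θ δ t)
  rw [YBWalk.path, YBWalk.path, points_equiv e hpt hmids]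
  -- the walk crosses at least one mid-edge (`head_eq`), so its point list is nonempty
  have hne : γ.points Θ δ ≠ [] := by
    intro h
    rw [YBWalk.points, List.map_eq_nil_iff] at h
    have := γ.head_eq
    rw [h] at this
    simp at this
  obtain ⟨x, l, hxl⟩ := List.exists_cons_of_ne_nil hne
  rw [hxl]
  exact polyline_map_cons F hF x l t

include hwt in
/-- **The weight measure is pushed forward to the weight measure** (at `x = 1`). [folklore] -/
theorem map_ybWeight : (ybWeight Θ Ω δ 1 a b).map e = ybWeight Θ Ω' δ 1 a' b' := by
  have hTm : Measurable e := YBWalk.measurable_of_top _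
  rw [ybWeight, Measure.map_sum hTm.aemeasurable]
  simp only [Measure.map_smul, Measure.map_dirac' hTm]
  rw [ybWeight, ← Measure.sum_comp_equiv e]
  congr 1
  funext γ
  simp only [Function.comp_apply, hwt γ, Real.one_rpow]

include hwt in
/-- **The law is pushed forward to the law** (at `x = 1`). [folklore] -/
theorem map_ybLaw : (ybLaw Θ Ω δ 1 a b).map e = ybLaw Θ Ω' δ 1 a' b' := by
  have hTm : Measurable e := YBWalk.measurable_of_top _
  rw [ybLaw, Measure.map_smul, map_ybWeight e hwt, ybLaw, ← map_ybWeight e hwt,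
    Measure.map_apply hTm MeasurableSet.univ, Set.preimage_univ]

include hF hpt hmids hwt in
/-- **S3, for the given data.** [folklore] -/
theorem map_curve_ybLaw :
    (ybLaw Θ Ω' δ 1 a' b').map (fun γ => γ.curve Θ δ) =
      ((ybLaw Θ Ω δ 1 a b).map (fun γ => γ.curve Θ δ)).map (CurveClass.map (F : C(ℂ, ℂ))) := by
  have hTm : Measurable e := YBWalk.measurable_of_top _
  rw [Measure.map_map (CurveClass.measurable_map _) (YBWalk.measurable_of_top _), ← map_ybLaw e hwt,
    Measure.map_map (YBWalk.measurable_of_top _) hTm]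
  congr 1
  funext γ
  show (e γ).curve Θ δ = CurveClass.map (F : C(ℂ, ℂ)) (γ.curve Θ δ)
  exact curve_equiv e hF hpt hmids γ

end LawTransportProof

/-- **Stub `stub_lawTransport` of line `grid_transpose` (crux `MirrorRotation`, stmt-CriticalPhenomena-16997),
VERBATIM**: a weight-preserving equivalence of Yang–Baxter walk types acting on edge lists by `E`, intertwined by a
plane homeomorphism `F` affine on segments, pushes the critical finite-volume curve law to the critical
finite-volume curve law of the image data. [folklore] -/
theorem stub_lawTransport :
    ∀ (Θ : ℤ → ℝ) (δ : ℝ) (Ω Ω' : Set ℂ) (a b a' b' : MidEdge) (E : MidEdge → MidEdge) (F : ℂ ≃ₜ ℂ)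
      (e : YangBaxterSAW Θ Ω δ a b ≃ YangBaxterSAW Θ Ω' δ a' b'),
      (∀ (x y : ℂ) (t : ℝ), F (AffineMap.lineMap x y t) = AffineMap.lineMap (F x) (F y) t) →
      (∀ x : MidEdge, (δ : ℂ) * planeMidpoint Θ (E x) = F ((δ : ℂ) * planeMidpoint Θ x)) →
      (∀ γ : YangBaxterSAW Θ Ω δ a b, (e γ).mids = γ.mids.map E) →
      (∀ γ : YangBaxterSAW Θ Ω δ a b, (e γ).weight Θ = γ.weight Θ) →
      (ybLaw Θ Ω' δ 1 a' b').map (fun γ => γ.curve Θ δ) =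
        ((ybLaw Θ Ω δ 1 a b).map (fun γ => γ.curve Θ δ)).map (CurveClass.map (F : C(ℂ, ℂ))) :=
  fun _ _ _ _ _ _ _ _ _ _ e hF hpt hmids hwt => LawTransportProof.map_curve_ybLaw e hF hpt hmids hwt



/-! ## SymmetryPassage -/


namespace SymmetryPassageProof

/-- The Yang–Baxter law is `0` (junk) or a probability measure. [folklore] -/
theorem ybLaw_eq_zero_or_isProbabilityMeasure (Θ : ℤ → ℝ) (Ω : Set ℂ) (δ x : ℝ) (a b : MidEdge) :
    ybLaw Θ Ω δ x a b = 0 ∨ IsProbabilityMeasure (ybLaw Θ Ω δ x a b) := by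
  by_cases h0 : ybWeight Θ Ω δ x a b Set.univ = 0
  · left
    rw [ybLaw, Measure.measure_univ_eq_zero.1 h0, smul_zero]
  by_cases ht : ybWeight Θ Ω δ x a b Set.univ = ⊤
  · left
    rw [ybLaw, ht, ENNReal.inv_top, zero_smul]
  · right
    exact isProbabilityMeasure_ybLaw h0 ht

/-- Convergence in law is preserved by composition with a continuous map (portmanteau form; copy of
`PinTheShear.tendstoLaw_comp_continuous`). [folklore] -/
theorem tendstoLaw_comp_continuous {Ωδ : ℝ → Type*} [∀ δ, MeasurableSpace (Ωδ δ)] {Ω' : Type*}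
    [MeasurableSpace Ω'] {X Y : Type*} [TopologicalSpace X] [TopologicalSpace Y]
    {Z : ∀ δ, Ωδ δ → X} {P : ∀ δ, Measure (Ωδ δ)} {W : Ω' → X} {P' : Measure Ω'}
    (h : TendstoLaw Z P W P') (g : C(X, Y)) :
    TendstoLaw (fun δ ω => g (Z δ ω)) P (fun ω => g (W ω)) P' := by
  intro f
  simpa only [BoundedContinuousFunction.compContinuous_apply] using h (f.compContinuous g)

/-- Two `C`-close continuous maps push every curve class to `C`-close curve classes (compare the identity
reparametrisation). [folklore] -/
theorem dist_map_map_le {Φ Ψ : C(ℂ, ℂ)} {C : ℝ} (hC : 0 ≤ C) (h : ∀ z, dist (Φ z) (Ψ z) ≤ C)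
    (c : CurveClass ℂ) : dist (CurveClass.map Φ c) (CurveClass.map Ψ c) ≤ C := by
  obtain ⟨γ, rfl⟩ := CurveClass.surjective_mk c
  rw [CurveClass.map_mk, CurveClass.map_mk, CurveClass.dist_mk_mk]
  exact (Curve.dist_le_dist_toContinuousMap _ _).trans ((ContinuousMap.dist_le hC).2 fun t => h (γ t))

/-- `|δ| → 0` along `δ → 0⁺`. [folklore] -/
theorem tendsto_abs_nhdsWithin_zero : Tendsto (fun δ : ℝ => |δ|) (𝓝[>] (0 : ℝ)) (𝓝 0) := by
  have : Tendsto (fun δ : ℝ => |δ|) (𝓝 0) (𝓝 |(0 : ℝ)|) := continuous_abs.tendsto 0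
  rw [abs_zero] at this
  exact this.mono_left nhdsWithin_le_nhds

/-- **Endpoint convergence of the image family**: if `z_δ → p`, `z'_δ = T_δ z_δ` eventually and `T_δ` is
`|δ|`-close to the continuous `S`, then `z'_δ → S p`. [folklore] -/
theorem tendsto_of_intertwined {T : ℝ → ℂ ≃ₜ ℂ} {S : ℂ ≃ₜ ℂ} (hdist : ∀ (δ : ℝ) (z : ℂ), dist (T δ z) (S z) ≤ |δ|)
    {z z' : ℝ → ℂ} {p : ℂ} (hz : Tendsto z (𝓝[>] (0 : ℝ)) (𝓝 p))
    (hz' : ∀ᶠ δ in 𝓝[>] (0 : ℝ), z' δ = T δ (z δ)) : Tendsto z' (𝓝[>] (0 : ℝ)) (𝓝 (S p)) := by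
  have hS : Tendsto (fun δ => S (z δ)) (𝓝[>] (0 : ℝ)) (𝓝 (S p)) := (S.continuous.tendsto p).comp hz
  have hT : Tendsto (fun δ => T δ (z δ)) (𝓝[>] (0 : ℝ)) (𝓝 (S p)) := by
    refine hS.congr_dist (squeeze_zero (fun _ => dist_nonneg) (fun δ => ?_) tendsto_abs_nhdsWithin_zero)
    rw [dist_comm]
    exact hdist δ (z δ)
  exact hT.congr' (hz'.mono fun δ h => h.symm)

end SymmetryPassageProof

open SymmetryPassageProof in
/-- **Stub `stub_symmetryPassage` of line `grid_transpose` (crux `MirrorRotation`, stmt-CriticalPhenomena-16997),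
VERBATIM**: exact finite-volume symmetries `T_δ → S` of the critical Yang–Baxter walk pass to a robust limit,
`P (S D) = S_* (P D)`. [folklore] -/
theorem stub_symmetryPassage :
    ∀ (α : ℝ) (P : ChordalFamily), P.IsChordal →
      (∀ (D : DobrushinDomain) (u : ℝ → ℂ) (a b : ℝ → MidEdge), (∀ᶠ δ in 𝓝[>] (0 : ℝ), ‖u δ‖ ≤ δ) →
        (∀ᶠ δ in 𝓝[>] (0 : ℝ), Nonempty (YangBaxterSAW (fun (_ : ℤ) => α)
          ((D.map (similarity 1 one_ne_zero (u δ))).carrier) δ (a δ) (b δ))) →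
        Tendsto (fun δ : ℝ => (δ : ℂ) * planeMidpoint (fun (_ : ℤ) => α) (a δ)) (𝓝[>] (0 : ℝ))
          (𝓝 (D.pt 0)) →
        Tendsto (fun δ : ℝ => (δ : ℂ) * planeMidpoint (fun (_ : ℤ) => α) (b δ)) (𝓝[>] (0 : ℝ))
          (𝓝 (D.pt 1)) →
        TendstoLaw (fun δ (γ : YangBaxterSAW (fun (_ : ℤ) => α)
            ((D.map (similarity 1 one_ne_zero (u δ))).carrier) δ (a δ) (b δ)) =>
            γ.curve (fun (_ : ℤ) => α) δ)
          (fun δ => ybLaw (fun (_ : ℤ) => α) ((D.map (similarity 1 one_ne_zero (u δ))).carrier) δ 1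
            (a δ) (b δ)) id (P D)) →
      ∀ (S : ℂ ≃ₜ ℂ) (T : ℝ → ℂ ≃ₜ ℂ) (D : DobrushinDomain) (u : ℝ → ℂ) (a b a' b' : ℝ → MidEdge),
        IsYBEndpointApprox (fun (_ : ℤ) => α) D a b →
        (∀ᶠ δ in 𝓝[>] (0 : ℝ), ‖u δ‖ ≤ δ) →
        (∀ᶠ δ in 𝓝[>] (0 : ℝ), Nonempty (YangBaxterSAW (fun (_ : ℤ) => α)
          (((D.map S).map (similarity 1 one_ne_zero (u δ))).carrier) δ (a' δ) (b' δ))) →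
        (∀ (δ : ℝ) (z : ℂ), dist (T δ z) (S z) ≤ |δ|) →
        (∀ᶠ (δ : ℝ) in 𝓝[>] (0 : ℝ),
          (δ : ℂ) * planeMidpoint (fun (_ : ℤ) => α) (a' δ) =
              T δ ((δ : ℂ) * planeMidpoint (fun (_ : ℤ) => α) (a δ)) ∧
            (δ : ℂ) * planeMidpoint (fun (_ : ℤ) => α) (b' δ) =
              T δ ((δ : ℂ) * planeMidpoint (fun (_ : ℤ) => α) (b δ))) →
        (∀ᶠ δ in 𝓝[>] (0 : ℝ),
          (ybLaw (fun (_ : ℤ) => α) (((D.map S).map (similarity 1 one_ne_zero (u δ))).carrier) δ 1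
              (a' δ) (b' δ)).map (fun γ => γ.curve (fun (_ : ℤ) => α) δ) =
            ((ybLaw (fun (_ : ℤ) => α) D.carrier δ 1 (a δ) (b δ)).map
              (fun γ => γ.curve (fun (_ : ℤ) => α) δ)).map (CurveClass.map (T δ : C(ℂ, ℂ)))) →
        P (D.map S) = (P D).map (CurveClass.map (S : C(ℂ, ℂ))) := by
  intro α P hP hRL S T D u a b a' b' hab hu hne hdist hpt hlaw
  haveI : IsProbabilityMeasure (P D) := (hP D).1
  haveI : IsProbabilityMeasure (P (D.map S)) := (hP (D.map S)).1
  -- (1) the source laws converge to `P D`: `RL` at the zero shift, transported along the carrier identity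
  have h0 := hRL D (fun _ : ℝ => (0 : ℂ)) a b (by
    filter_upwards [self_mem_nhdsWithin] with δ hδ
    simpa using le_of_lt hδ)
  have hcar : (D.map (similarity 1 one_ne_zero 0)).carrier = D.carrier := by
    ext z; simp [MarkedDomain.carrier_map]
  have key : ∀ X : Set ℂ, X = D.carrier →
      ((∀ᶠ δ in 𝓝[>] (0 : ℝ), Nonempty (YangBaxterSAW (fun (_ : ℤ) => α) X δ (a δ) (b δ))) →
        Tendsto (fun δ : ℝ => (δ : ℂ) * planeMidpoint (fun (_ : ℤ) => α) (a δ)) (𝓝[>] (0 : ℝ))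
          (𝓝 (D.pt 0)) →
        Tendsto (fun δ : ℝ => (δ : ℂ) * planeMidpoint (fun (_ : ℤ) => α) (b δ)) (𝓝[>] (0 : ℝ))
          (𝓝 (D.pt 1)) →
        TendstoLaw (fun δ (γ : YangBaxterSAW (fun (_ : ℤ) => α) X δ (a δ) (b δ)) =>
            γ.curve (fun (_ : ℤ) => α) δ)
          (fun δ => ybLaw (fun (_ : ℤ) => α) X δ 1 (a δ) (b δ)) id (P D)) →
      TendstoLaw (fun δ (γ : YangBaxterSAW (fun (_ : ℤ) => α) D.carrier δ (a δ) (b δ)) =>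
          γ.curve (fun (_ : ℤ) => α) δ)
        (fun δ => ybLaw (fun (_ : ℤ) => α) D.carrier δ 1 (a δ) (b δ)) id (P D) := by
    intro X hX h
    subst hX
    exact h hab.nonempty hab.tendsto_fst hab.tendsto_snd
  have hsrc := key _ hcar h0
  -- (2) the target laws converge to `P (S D)`: `RL` at `S D` with the shifts `u`
  have hA' : Tendsto (fun δ : ℝ => (δ : ℂ) * planeMidpoint (fun (_ : ℤ) => α) (a' δ)) (𝓝[>] (0 : ℝ))
      (𝓝 ((D.map S).pt 0)) :=
    tendsto_of_intertwined hdist hab.tendsto_fst (hpt.mono fun δ h => h.1)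
  have hB' : Tendsto (fun δ : ℝ => (δ : ℂ) * planeMidpoint (fun (_ : ℤ) => α) (b' δ)) (𝓝[>] (0 : ℝ))
      (𝓝 ((D.map S).pt 1)) :=
    tendsto_of_intertwined hdist hab.tendsto_snd (hpt.mono fun δ h => h.2)
  have htgt := hRL (D.map S) u a' b' hu hne hA' hB'
  -- (3) the `S`-images, then the `T_δ`-images, of the source curves converge to `S_* (P D)`
  have hY' := tendstoLaw_comp_continuous hsrc ⟨CurveClass.map (S : C(ℂ, ℂ)), CurveClass.continuous_map _⟩
  have hY : TendstoLaw
      (fun δ (γ : YangBaxterSAW (fun (_ : ℤ) => α) D.carrier δ (a δ) (b δ)) =>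
        CurveClass.map (T δ : C(ℂ, ℂ)) (γ.curve (fun (_ : ℤ) => α) δ))
      (fun δ => ybLaw (fun (_ : ℤ) => α) D.carrier δ 1 (a δ) (b δ))
      (fun c => CurveClass.map (S : C(ℂ, ℂ)) (id c)) (P D) :=
    tendstoLaw_of_dist_le (fun δ => ybLaw_eq_zero_or_isProbabilityMeasure _ _ _ _ _ _)
      (fun δ => (YBWalk.measurable_of_top _).aemeasurable) (fun δ => (YBWalk.measurable_of_top _).aemeasurable)
      (CurveClass.measurable_map _).aemeasurable tendsto_abs_nhdsWithin_zero
      (fun δ γ => dist_map_map_le (abs_nonneg δ) (hdist δ) _) hY'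
  -- (4) uniqueness of limits in law
  refine ext_of_forall_integral_eq_of_IsFiniteMeasure fun f => ?_
  have h1 := htgt f
  have h2 := hY f
  have h12 : (fun δ => ∫ γ, f (γ.curve (fun (_ : ℤ) => α) δ)
        ∂(ybLaw (fun (_ : ℤ) => α) (((D.map S).map (similarity 1 one_ne_zero (u δ))).carrier) δ 1 (a' δ) (b' δ)))
      =ᶠ[𝓝[>] (0 : ℝ)] fun δ => ∫ γ, f (CurveClass.map (T δ : C(ℂ, ℂ)) (γ.curve (fun (_ : ℤ) => α) δ))
        ∂(ybLaw (fun (_ : ℤ) => α) D.carrier δ 1 (a δ) (b δ)) := by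
    filter_upwards [hlaw] with δ hδ
    have e1 : ∫ γ, f (γ.curve (fun (_ : ℤ) => α) δ)
        ∂(ybLaw (fun (_ : ℤ) => α) (((D.map S).map (similarity 1 one_ne_zero (u δ))).carrier) δ 1 (a' δ) (b' δ)) =
        ∫ c, f c ∂((ybLaw (fun (_ : ℤ) => α) (((D.map S).map (similarity 1 one_ne_zero (u δ))).carrier) δ 1
          (a' δ) (b' δ)).map (fun γ => γ.curve (fun (_ : ℤ) => α) δ)) :=
      (integral_map (YBWalk.measurable_of_top _).aemeasurable f.continuous.aestronglyMeasurable).symm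
    rw [e1, hδ, Measure.map_map (CurveClass.measurable_map _) (YBWalk.measurable_of_top _),
      integral_map (YBWalk.measurable_of_top _).aemeasurable f.continuous.aestronglyMeasurable]
    rfl
  have h := tendsto_nhds_unique (h1.congr' h12) h2
  rw [integral_map (CurveClass.measurable_map _).aemeasurable f.continuous.aestronglyMeasurable]
  simpa using h



/-! ## RotationOfMirrors -/


namespace RotationOfMirrorsProof

/-- The mirror `m_α : z ↦ e^{iα} z̄` (spelled as in the stub). [folklore] -/
abbrev mirror (α : ℝ) : ℂ ≃ₜ ℂ :=
  Complex.conjLIE.toHomeomorph.trans (similarity (Complex.exp ((α : ℂ) * Complex.I)) (Complex.exp_ne_zero _) 0)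

/-- The rotation `z ↦ e^{iφ} z` about the origin. [folklore] -/
abbrev rot (φ : ℝ) : ℂ ≃ₜ ℂ := similarity (Complex.exp ((φ : ℂ) * Complex.I)) (Complex.exp_ne_zero _) 0

/-- Two mirrors compose to a rotation: `m_α ∘ m_β = rot(α − β)`. [folklore] -/
theorem mirror_trans_mirror (α β : ℝ) : (mirror β).trans (mirror α) = rot (α - β) := by
  ext1 z
  rw [Homeomorph.trans_apply, conjLIE_toHomeomorph_trans_similarity_apply,
    conjLIE_toHomeomorph_trans_similarity_apply, similarity_apply, add_zero, add_zero, add_zero, map_mul,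
    Complex.conj_conj, ← Complex.exp_conj, map_mul, Complex.conj_ofReal, Complex.conj_I, ← mul_assoc,
    ← Complex.exp_add]
  congr 1
  push_cast
  ring_nf

/-- Three equal rotations compose to the triple rotation. [folklore] -/
theorem rot_trans_rot_trans_rot (φ : ℝ) : ((rot φ).trans (rot φ)).trans (rot φ) = rot (3 * φ) := by
  ext1 z
  rw [Homeomorph.trans_apply, Homeomorph.trans_apply, similarity_apply, similarity_apply, similarity_apply,
    similarity_apply, add_zero, add_zero, add_zero, add_zero, ← mul_assoc, ← mul_assoc, ← Complex.exp_add,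
    ← Complex.exp_add]
  congr 1
  push_cast
  ring

variable {P : ChordalFamily}

/-- Covariance under the rotations by `|φ| ≤ π/3`, from mirror covariance on `[π/3, 2π/3]`. [folklore] -/
theorem rot_covariant_of_mirror
    (hmir : ∀ α ∈ Set.Icc (Real.pi / 3) (2 * Real.pi / 3), ∀ D : DobrushinDomain,
      P (D.map (mirror α)) = (P D).map (CurveClass.map (mirror α : C(ℂ, ℂ))))
    (φ : ℝ) (hφ : |φ| ≤ Real.pi / 3) (D : DobrushinDomain) :
    P (D.map (rot φ)) = (P D).map (CurveClass.map (rot φ : C(ℂ, ℂ))) := by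
  obtain ⟨h1, h2⟩ := abs_le.1 hφ
  have hα : Real.pi / 2 + φ / 2 ∈ Set.Icc (Real.pi / 3) (2 * Real.pi / 3) := by
    constructor <;> linarith [Real.pi_pos]
  have hβ : Real.pi / 2 - φ / 2 ∈ Set.Icc (Real.pi / 3) (2 * Real.pi / 3) := by
    constructor <;> linarith [Real.pi_pos]
  have key := ChordalFamily.covariant_trans (P := P) (CurveClass.measurable_map _) (CurveClass.measurable_map _)
    (hmir _ hβ) (hmir _ hα) D
  rw [mirror_trans_mirror, show Real.pi / 2 + φ / 2 - (Real.pi / 2 - φ / 2) = φ by ring] at key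
  exact key


end RotationOfMirrorsProof

open RotationOfMirrorsProof in
/-- **Stub `stub_rotationOfMirrors` (crux `MirrorRotation`, stmt-CriticalPhenomena-16997), VERBATIM**: mirror
covariance at every angle of `[π/3, 2π/3]` gives covariance under every rotation about the origin. [folklore] -/
theorem stub_rotationOfMirrors :
    ∀ P : ChordalFamily,
      (∀ α ∈ Set.Icc (Real.pi / 3) (2 * Real.pi / 3), ∀ D : DobrushinDomain,
        P (D.map (Complex.conjLIE.toHomeomorph.trans
            (similarity (Complex.exp ((α : ℂ) * Complex.I)) (Complex.exp_ne_zero _) 0))) =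
          (P D).map (CurveClass.map
            ((Complex.conjLIE.toHomeomorph.trans
              (similarity (Complex.exp ((α : ℂ) * Complex.I)) (Complex.exp_ne_zero _) 0) : ℂ ≃ₜ ℂ) :
              C(ℂ, ℂ)))) →
      ∀ (D : DobrushinDomain) (c : ℂ) (hc : c ≠ 0), ‖c‖ = 1 →
        P (D.map (similarity c hc 0)) = (P D).map (CurveClass.map (similarity c hc 0 : C(ℂ, ℂ))) := by
  intro P hmir D c hc hc1
  set φ : ℝ := Complex.arg c / 3 with hφdef
  have hφ : |φ| ≤ Real.pi / 3 := by
    rw [hφdef, abs_div, abs_of_pos (by norm_num : (0 : ℝ) < 3)]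
    have := Complex.abs_arg_le_pi c
    linarith
  have h1 := rot_covariant_of_mirror (P := P) hmir φ hφ
  have h2 := ChordalFamily.covariant_trans (P := P) (CurveClass.measurable_map _) (CurveClass.measurable_map _) h1 h1
  have h3 := ChordalFamily.covariant_trans (P := P) (CurveClass.measurable_map _) (CurveClass.measurable_map _) h2 h1 D
  rw [rot_trans_rot_trans_rot, show 3 * φ = Complex.arg c by rw [hφdef]; ring] at h3
  have hexp : Complex.exp ((Complex.arg c : ℂ) * I) = c := by
    have := Complex.norm_mul_exp_arg_mul_I c
    rwa [hc1, Complex.ofReal_one, one_mul] at this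
  have key : similarity c hc 0 = rot (Complex.arg c) := by
    ext1 z
    rw [similarity_apply, similarity_apply, hexp]
  rw [key]
  exact h3



/-! ### Glue: mirror covariance at one angle, then the crux -/

/-- The mid-edge transposition `E`: `vert k j ↦ slant j k`, `slant k j ↦ vert j k`. [folklore] -/
def tEdge : MidEdge → MidEdge
  | .vert k j => .slant j k
  | .slant k j => .vert j k

/-- The mirror `m_α : z ↦ e^{iα} z̄` across the line `e^{iα/2} ℝ`. [folklore] -/
abbrev mirror (α : ℝ) : ℂ ≃ₜ ℂ :=
  Complex.conjLIE.toHomeomorph.trans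
    (similarity (Complex.exp ((α : ℂ) * Complex.I)) (Complex.exp_ne_zero _) 0)

/-- The lattice mirror `m_{α,δ} : z ↦ e^{iα} z̄ − (iδ/2)(1 + e^{iα})`. [folklore] -/
abbrev latticeMirror (α δ : ℝ) : ℂ ≃ₜ ℂ :=
  Complex.conjLIE.toHomeomorph.trans
    (similarity (Complex.exp ((α : ℂ) * Complex.I)) (Complex.exp_ne_zero _)
      (-((δ : ℂ) * Complex.I * (1 + Complex.exp ((α : ℂ) * Complex.I)) / 2)))

/-- The offset `c_α = −(i/2)(1 + e^{iα})`: `m_{α,δ} = m_α + δ c_α`. [folklore] -/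
def offset (α : ℝ) : ℂ := -(Complex.I * (1 + Complex.exp ((α : ℂ) * Complex.I)) / 2)

/-- Walk types over equal face sets are equivalent, with the same edge lists and weights. [folklore] -/
def domEquiv {D₁ D₂ : Set Face} (h : D₁ = D₂) (a z : MidEdge) : YBWalk D₁ a z ≃ YBWalk D₂ a z where
  toFun := YBWalk.mapDomain h.subset
  invFun := YBWalk.mapDomain h.symm.subset
  left_inv _ := YBWalk.ext rfl
  right_inv _ := YBWalk.ext rfl

/-- Bookkeeping. [folklore] -/
@[simp] theorem mids_domEquiv {D₁ D₂ : Set Face} (h : D₁ = D₂) (a z : MidEdge) (γ : YBWalk D₁ a z) :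
    (domEquiv h a z γ).mids = γ.mids := rfl

/-- Bookkeeping. [folklore] -/
@[simp] theorem weight_domEquiv {D₁ D₂ : Set Face} (h : D₁ = D₂) (a z : MidEdge) (Θ : ℤ → ℝ)
    (γ : YBWalk D₁ a z) : (domEquiv h a z γ).weight Θ = γ.weight Θ := rfl

/-- The shifted mirrored domain is the lattice-mirrored domain: `(m_α D) + δ c_α = m_{α,δ} D`. [folklore] -/
theorem carrier_target (D : DobrushinDomain) (α δ : ℝ) :
    ((D.map (mirror α)).map (similarity 1 one_ne_zero ((δ : ℂ) * offset α))).carrier =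
      latticeMirror α δ '' D.carrier := by
  rw [MarkedDomain.carrier_map, MarkedDomain.carrier_map, Set.image_image]
  refine Set.image_congr fun z _ => ?_
  simp only [Homeomorph.trans_apply, similarity_apply, offset]
  ring

/-- `‖c_α‖ ≤ 1`. [folklore] -/
theorem norm_offset_le (α : ℝ) : ‖offset α‖ ≤ 1 := by
  have h1 : ‖Complex.exp ((α : ℂ) * Complex.I)‖ = 1 := Complex.norm_exp_ofReal_mul_I α
  have h2 : ‖(1 : ℂ) + Complex.exp ((α : ℂ) * Complex.I)‖ ≤ 2 := by
    calc ‖(1 : ℂ) + Complex.exp ((α : ℂ) * Complex.I)‖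
        ≤ ‖(1 : ℂ)‖ + ‖Complex.exp ((α : ℂ) * Complex.I)‖ := norm_add_le _ _
      _ = 2 := by rw [h1, norm_one]; norm_num
  unfold offset
  rw [norm_neg, norm_div, norm_mul, Complex.norm_I, one_mul, Complex.norm_ofNat]
  linarith

/-- **Mirror covariance at one angle.**  If `P` is chordal, is the robust full limit of the critical
constant-angle-`α` Yang–Baxter walk, and every Dobrushin domain has an angle-`α` endpoint approximation, then
`P (m_α D) = (m_α)_* (P D)`: S1 at the face set `(D.carrier)_δ` with S2 (G2) and `carrier_target` give the
per-mesh equivalence `YBSAW_α(D; a, b) ≃ YBSAW_α(m_α D + δ c_α; E a, E b)`, S3 the law identity, S4 the passage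
(`S = m_α`, `T_δ = m_{α,δ}`, `u_δ = δ c_α`). [folklore] -/
theorem mirrorCovariant_of (α : ℝ) {P : ChordalFamily} (hP : P.IsChordal)
    (hRL : ∀ (D : DobrushinDomain) (u : ℝ → ℂ) (a b : ℝ → MidEdge), (∀ᶠ δ in 𝓝[>] (0 : ℝ), ‖u δ‖ ≤ δ) →
        (∀ᶠ δ in 𝓝[>] (0 : ℝ), Nonempty (YangBaxterSAW (fun (_ : ℤ) => α)
          ((D.map (similarity 1 one_ne_zero (u δ))).carrier) δ (a δ) (b δ))) →
        Tendsto (fun δ : ℝ => (δ : ℂ) * planeMidpoint (fun (_ : ℤ) => α) (a δ)) (𝓝[>] (0 : ℝ))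
          (𝓝 (D.pt 0)) →
        Tendsto (fun δ : ℝ => (δ : ℂ) * planeMidpoint (fun (_ : ℤ) => α) (b δ)) (𝓝[>] (0 : ℝ))
          (𝓝 (D.pt 1)) →
        TendstoLaw (fun δ (γ : YangBaxterSAW (fun (_ : ℤ) => α)
            ((D.map (similarity 1 one_ne_zero (u δ))).carrier) δ (a δ) (b δ)) =>
            γ.curve (fun (_ : ℤ) => α) δ)
          (fun δ => ybLaw (fun (_ : ℤ) => α) ((D.map (similarity 1 one_ne_zero (u δ))).carrier) δ 1
            (a δ) (b δ)) id (P D))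
    (hEA : ∀ D : DobrushinDomain, ∃ a b : ℝ → MidEdge, IsYBEndpointApprox (fun (_ : ℤ) => α) D a b)
    (D : DobrushinDomain) :
    P (D.map (mirror α)) = (P D).map (CurveClass.map (mirror α : C(ℂ, ℂ))) := by
  obtain ⟨a, b, hab⟩ := hEA D
  have hG := fun δ : ℝ => stub_latticeMirrorGeometry tEdge (fun _ _ => rfl) (fun _ _ => rfl) α δ
  -- the per-mesh equivalence of walk types
  have key : ∀ δ : ℝ, ∃ e : YangBaxterSAW (fun (_ : ℤ) => α) D.carrier δ (a δ) (b δ) ≃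
      YangBaxterSAW (fun (_ : ℤ) => α)
        (((D.map (mirror α)).map (similarity 1 one_ne_zero ((δ : ℂ) * offset α))).carrier) δ
        (tEdge (a δ)) (tEdge (b δ)),
      (∀ γ, (e γ).mids = γ.mids.map tEdge) ∧
        ∀ γ, (e γ).weight (fun (_ : ℤ) => α) = γ.weight (fun (_ : ℤ) => α) := by
    intro δ
    obtain ⟨e₁, he₁⟩ := stub_transposeWalks tEdge (fun _ _ => rfl) (fun _ _ => rfl) α
      (meshFaces (fun (_ : ℤ) => α) D.carrier δ) (a δ) (b δ)
    have hset : meshFaces (fun (_ : ℤ) => α)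
        (((D.map (mirror α)).map (similarity 1 one_ne_zero ((δ : ℂ) * offset α))).carrier) δ =
        Prod.swap '' meshFaces (fun (_ : ℤ) => α) D.carrier δ := by
      rw [carrier_target]
      exact (hG δ).2.1 D.carrier
    refine ⟨e₁.trans (domEquiv hset.symm _ _), fun γ => ?_, fun γ => ?_⟩
    · rw [Equiv.trans_apply, mids_domEquiv]
      exact (he₁ γ).1
    · rw [Equiv.trans_apply, weight_domEquiv]
      exact (he₁ γ).2
  choose eqv heqv_mids heqv_wt using key
  refine stub_symmetryPassage α P hP hRL (mirror α) (fun δ => latticeMirror α δ) D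
    (fun δ => (δ : ℂ) * offset α) a b (fun δ => tEdge (a δ)) (fun δ => tEdge (b δ)) hab ?_ ?_
    (fun δ z => (hG δ).2.2.1 z) ?_ ?_
  · -- `‖δ c_α‖ ≤ δ`
    filter_upwards [self_mem_nhdsWithin] with δ hδ
    rw [norm_mul, Complex.norm_real, Real.norm_eq_abs, abs_of_pos (Set.mem_Ioi.1 hδ)]
    exact mul_le_of_le_one_right (le_of_lt (Set.mem_Ioi.1 hδ)) (norm_offset_le α)
  · -- the mirrored walk spaces are eventually nonempty
    filter_upwards [hab.nonempty] with δ hδ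
    obtain ⟨γ⟩ := hδ
    exact ⟨eqv δ γ⟩
  · -- the mirrored endpoints are intertwined by `m_{α,δ}`
    exact Eventually.of_forall fun δ => ⟨(hG δ).1 (a δ), (hG δ).1 (b δ)⟩
  · -- the finite-volume law identity
    exact Eventually.of_forall fun δ =>
      stub_lawTransport (fun (_ : ℤ) => α) δ D.carrier _ (a δ) (b δ) (tEdge (a δ)) (tEdge (b δ)) tEdge
        (latticeMirror α δ) (eqv δ) ((hG δ).2.2.2) ((hG δ).1) (heqv_mids δ) (heqv_wt δ)

/-! ### The crux -/

/-- **`MirrorRotation` (route `SAWTrackTransport`, item stmt-CriticalPhenomena-16997), PROVED** — the reflection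
trick: angle universality, endpoint approximations at every angle of `[π/3, 2π/3]` and the robust full square limit
give covariance of the limit under every rotation about the origin (mirror covariance at each angle of the
interval, `mirrorCovariant_of`; mirrors generate rotations, S5). [folklore] -/
theorem mirrorRotation : Summit.CriticalPhenomena.SAWScalingLimit.Theses.SAWTrackTransport.MirrorRotation := by
  intro hAU hEP P hP hRL D c hc hc1
  exact stub_rotationOfMirrors P (fun α hα D' => mirrorCovariant_of α hP (hAU α hα P hP hRL) (hEP α hα) D')
    D c hc hc1

end Summit.CriticalPhenomena.SAWScalingLimit.Cruxes.MirrorRotation.GridTranspose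

end
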